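import Summits.QuantumFields.YangMills.Theorems.BalabanUVNodesN07ShearVariationOfTower
import Summits.QuantumFields.YangMills.Theorems.BalabanUVNodesN07DataDownTheTowerLevelBoxes
import Summits.QuantumFields.YangMills.Theorems.BalabanUVNodesN07SplitClauseRecordShearVariationAtCubeDomains
import HarnessLib

/-!
# N07 [B11] (= [15] = [Balaban1985Variational]) Sect. F, road of record R0′, WIDTH-209 row (r2), FILE 16: **THE ς-DOOR AT THE HEAD's FAMILY WITH THE SHEAR LETTER SUPPLIED** —
# FILE 11's `…_recordShearVariation_dominated_cubeDomains_box` with its ONLY shear-side letter `hvar` DISCHARGED on [6] p. 98's `□̃`-tower: what the shear side of row (r2) now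
# displays is the data lane's per-level letters `a_i, τ_i` of the representative's averages on the `□̃`-tower, the top letter `v_k`, S3's letter `t` on `□̃`, and ONE smallness `ς ≤ ½`

Cell `pub-ymgap`, width seat `pub-ymgap-dag-n07-w8` g6, WIDTH-209 N07 row (r2) of road R0′, CLAIM-16 ∕ INTENT-16 (cell bus; own lineage FILES 11∕15 → FILE 16; dag-n07-w6 g2's
`N07DataDownTheTowerLevelBoxes` CONSUMED BY NAME, on their word «NOT MINE — GO … §1 names to cite»).  `--kind proof --supports stmt-QuantumFields-27364 --as helper` (K1⁹ per dag-lead KEY MAP v2);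
count-neutral; def-free.  [15] = [Balaban1985Variational] (144)–(145) pp. 300–301, (150)–(152) p. 301, (157)–(159) pp. 302–303, (164)–(165) p. 304, (168) p. 304; [6] = [Balaban1985RegularSpaces]
p. 98, (1.131) p. 99, Lemma 1 (1.25) p. 79; [4] = [Balaban1984PropagatorsII] (2.1)–(2.4) p. 224, Cor. 2.8 (2.150)–(2.151) p. 249; [3] = [Balaban1985Averaging] (8) p. 19, (85)–(88) p. 31.

THE POINT.  FILE 11 (p632914) delivers the S6 head's split clause at the cube family `cubeDomains (F.P K) a M ρ (K − n)` and window `π '' □′`, `□′ = box L a M (K − n)`, with ONE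
shear-side letter: `hvar : ∀ j ≤ K − n, ∀ y ∈ castSite '' [lo′ j, hi′ j], dist1 (g_j(castSite lo′_j)⁻¹·g_j(y)) ≤ ς` on the CANONICAL level boxes (dag-n07-w4 p627154's four equations).
FILE 15 supplies `hvar` on every sub-box family of a blow-down tower; dag-n07-w6 g2's `N07DataDownTheTowerLevelBoxes` shows that [6] p. 98's `□̃`-tower `[tlo L (tLo a ρ) (k−j), thi L (tHi a M ρ) (k−j)]`
IS a blow-down tower (`tildeTower_lo_step` ∕ `tildeTower_hi_step`) CARRYING the canonical boxes (`castSite_levelBoxes_subset_tildeTower`).  THIS FILE composes the three: (§1) `hvar` on the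
canonical boxes with the explicit, coordinate-uniform letter `ς_□̃ := 2d·(D·θ₀ + Σ_{i<k} (D ∕ L^{i+1} + 1)·θ_{i+1} + D·θ)`, `D := Lᵏ(M + 4ρ)` (`tHi_le_tLo_add`: every fine width of `□̃` is `≤ D − 1`;
`layerSum_mono`), `θ_i := τ_i + 7((d+2)L)²∕4·a_i + (d+1)(L−1)τ_i` (`i < k`), `θ_k := v_k`; (§2) the DOOR: FILE 11's conclusion `LocalGaugeSplitOn (π '' □′) η_{K−n} t (t₁ + (t₂ + t_∂) + t₃) U`
for every `t_∂ > 2CB₃·(4ς_□̃)` with the shear side reduced to: the per-level plaquette ∕ within-block letters `a_i, τ_i` of the averages of the representative `(U^{u})^{u♮}` on the `□̃`-tower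
(dag-n07-w6's binder shapes VERBATIM), the top letter `v_k` on `□̃^{(k)}`, S3's (152) equation and letter `t` on a bond set `B ⊇` the fine bonds of `□̃` (LOCATED-LANDAU-REGION, cell bus:
print's (152) holds on all `Ω′_j ∋ □̃`; the door's own `he`∕`hA` stay on `□′`), `1 ≤ M`, and the smallness `ς_□̃ ≤ ½`.

WHAT IS PROVED (sorry-free; no definition; axioms standard).
* §1 `width_tildeTower_zero_le` (`(thi … k κ − tlo … k κ).toNat ≤ Lᵏ(M + 4ρ)`) · ★★★ `centredShearVariation_le_tildeTower_levelBoxes` (`hvar` on the canonical boxes, letter `ς_□̃`, Landau letter `θ` generic).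
* §2 ★★★★ `localGaugeSplitOn_of_gauge152_recordShearTildeTower_cubeDomains_box F N` (statement in THE POINT).
HONEST SCOPE.  Count-neutral by-name composition of LANDED theorems (this base FILES 11∕13∕15; dag-n07-w6 g2 `N07DataDownTheTowerLevelBoxes` §1); the letters `a_i, τ_i, v_k`, S3's `(u, A, t)`,
the gauges and the smallness `ς_□̃ ≤ ½` are HYPOTHESES ∕ the consumer's (their sizes — [15] (145)∕(151)∕(152) — are the data ∕ S3 lanes' theorems, NOT typed here); nothing of [15]∕[6]∕[4]∕[3]
ANALYSIS asserted; the joint satisfiability with the head's budget NOT claimed; HCHART ∕ `LocalLettersSplitTopStepCore(G∕R)` ∕ `DatumGaugeSplitTopStepCore(G∕R)` ∕ `HalvingStepTop(Core)` ∕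
`stub_prop8StepCoP13` NOT discharged; K0⁷ ∕ K1⁹ NOT closed; N07 NOT discharged; counts unmoved (typed 28∕28 · discharged 5∕27); one finite 𝕋⁴ programme at fixed ε — the route closes the
conditional finite-𝕋⁴ rung `BalabanLadder.UV` ONLY; the YM mass gap (Clay) is NOT proved by any of this; nothing continuum ∕ ℝ⁴ ∕ OS.  No `sorry`, no `def`, no `instance`, no `notation`.

RELATED IN THE TREE, NOT DUPLICATED (stem check 2026-08-28T14:00Z: `ls …/Theorems | rg -i TildeTower` = ∅): FILE 11 (the door — CONSUMED, conclusion reproduced with `hvar` discharged),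
FILE 15 (the tower supplier — CONSUMED), dag-n07-w6 g2 `N07DataDownTheTowerLevelBoxes` (the `□̃` geometry and the coarse-bond `v`-clause on the same tower — §1 CONSUMED; its §2∕§3 are the
OTHER half of the head's HCHART data, not restated), dag-n07-w4 `N07SplitClauseHeadAtCubeDomains` (FILE 3 of the head, keyed on the σ-door p628904 — the ς-edition is the head's lineage).
-/

set_option autoImplicit false

noncomputable section
open scoped BigOperators Matrix.Norms.L2Operator

namespace Summit.QuantumFields.YangMills.BalabanUVNodes.N07SplitClauseOfTildeTower

open Literature.MathematicalPhysics.QuantumFieldTheory.Balaban1983to89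
open Literature.MathematicalPhysics.QuantumFieldTheory.Balaban1983to89.Node00
open Literature.MathematicalPhysics.QuantumFieldTheory.Balaban1983to89.B12RegularSpaces111 (gaugeU expI grad)
open B15Eq112TorusCover (cover)
open B14DomainGeom (Pt)
open B8Eq131Cubes (sqLo sqHi tLo tHi box cube)
open B8Ineq130 (tlo thi tlo_apply thi_apply)
open B6SectAOperatorsV1 (BondIdx)
open T4Continuum (T4Family)
open T4AxialGaugeSmallField (castSite)
open B16Sect1Backgrounds (toMS)
open GaugeField (gaugeAct)
open MatrixLog (mlog)
open ExpMeanLog (deltaSU)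
open Summit.QuantumFields.Balaban3D.Carriers (radialContourData)
open Summit.QuantumFields.YangMills.Theorems.K0FlatCubeOpsTextP (flatH)
open Summit.QuantumFields.YangMills.BalabanUVNodes.N07HalvingStepTopOfLocalLetters (Letters10On)
open Summit.QuantumFields.YangMills.BalabanUVNodes.N07LocalLettersSplitCore (LocalGaugeSplitOn)
open Summit.QuantumFields.YangMills.BalabanUVNodes.N07ShearVariationOfTower (layerSum_mono centredShearVariation_le_of_blowDown_sub)
open Summit.QuantumFields.YangMills.BalabanUVNodes.N07DataDownTheTowerLevelBoxes (tildeTower_lo_step tildeTower_hi_step tHi_le_tLo_add castSite_levelBoxes_subset_tildeTower)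
open Summit.QuantumFields.YangMills.BalabanUVNodes.N07SplitClauseRecordShearVariationAtCubeDomains (localGaugeSplitOn_of_gauge152_recordShearVariation_dominated_cubeDomains_box)

/-! ## §1  The shear letter on the canonical boxes from the `□̃`-tower -/

section Shear

variable {F : T4Family} {N : ℕ} [NeZero N] {K : ℕ}

/-- Every fine width of `□̃` is below `D := Lᵏ(M + 4ρ)`: `thi L (tHi a M ρ) k κ − tlo L (tLo a ρ) k κ = Lᵏ(tHi κ − tLo κ + 1) − 1 ≤ Lᵏ(M + 4ρ) − 1` (`1 ≤ M`; dag-n07-w6 g2 `tHi_le_tLo_add`).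
[cite: Balaban1985RegularSpaces, p.98 («A distance of its boundary to □ is equal to 2R₁M₁»)] -/
theorem width_tildeTower_zero_le (a : Fin (F.P K).d → ℤ) {M : ℕ} (ρ k : ℕ) (hM : 1 ≤ M) (κ : Fin (F.P K).d) :
    (thi (F.P K).L (tHi a M ρ) k κ - tlo (F.P K).L (tLo a ρ) k κ).toNat ≤ (F.P K).L ^ k * (M + 4 * ρ) := by
  have h1 := tHi_le_tLo_add a ρ hM κ
  have hL : (0 : ℤ) ≤ ((F.P K).L : ℤ) ^ k := by positivity
  rw [Int.toNat_le, thi_apply, tlo_apply]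
  have h2 : (((M + 4 * ρ - 1 : ℕ)) : ℤ) = (M : ℤ) + 4 * ρ - 1 := by
    rw [Nat.cast_sub (by omega : 1 ≤ M + 4 * ρ)]; push_cast; ring
  rw [h2] at h1
  push_cast
  nlinarith

/-- ★★★ **THE ς-DOOR's `hvar` ON THE CANONICAL BOXES, FROM THE `□̃`-TOWER**: shear gauge `u` (`u♮`), Landau copy `U₁`, representative `U′ := U₁^{u}`; height `1 ≤ k ≤ m + K`, `1 ≤ ρ`, `1 ≤ M`;
per-level plaquette letters `a_i` and within-block letters `τ_i` of `Mⁱ U′` on the `□̃`-tower boxes `castSite '' [tlo L (tLo a ρ) (k−i), thi L (tHi a M ρ) (k−i)]` (dag-n07-w6's shapes),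
`((d+2)L)²∕4·a_i < δ_N`, top letter `v_k` on `□̃^{(k)}`, Landau per-bond letter `0 ≤ θ` on the fine bonds of `□̃`; canonical boxes `lo′∕hi′` by p627154's four equations.  Then
`∀ j ≤ k, ∀ y ∈ castSite '' [lo′ j, hi′ j]: dist1 (g_j(castSite lo′_j)⁻¹·g_j(y)) ≤ 2d·(D·θ₀ + Σ_{i<k} (D ∕ L^{i+1} + 1)·θ_{i+1} + D·θ)`, `D := Lᵏ(M + 4ρ)` (FILE 15 §4 ∘ dag-n07-w6 g2 §1).
[cite: Balaban1985Variational, (144)–(145) pp.300–301, (151)–(152) p.301; Balaban1985RegularSpaces, p.98, (1.131) p.99, Lemma 1 (1.25) p.79; Balaban1987RG1, (0.1) p.251] -/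
theorem centredShearVariation_le_tildeTower_levelBoxes {k : ℕ} (hk1 : 1 ≤ k) (hk : k ≤ (F.P K).m + (F.P K).K)
    (u : GaugeTransf (F.P K) 0 (SU N)) (U₁ : GaugeField (F.P K) 0 (SU N)) (a : Fin (F.P K).d → ℤ) {M ρ : ℕ} (hρ : 1 ≤ ρ) (hM : 1 ≤ M)
    (aL τ : ℕ → ℝ) {vk θ : ℝ} (ha : ∀ i < k, 0 ≤ aL i) (hτ : ∀ i < k, 0 ≤ τ i) (hvk : 0 ≤ vk) (hθ : 0 ≤ θ)
    (ht : ∀ i < k, (((((F.P K).d + 2) * (F.P K).L : ℕ) : ℝ) ^ 2 / 4) * aL i < deltaSU (Fin N))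
    (hplaq : ∀ i < k, ∀ c : PBond (F.P K) (i + 1),
      c.src ∈ (castSite '' Set.Icc (tlo (F.P K).L (tLo a ρ) (k - (i + 1))) (thi (F.P K).L (tHi a M ρ) (k - (i + 1))) : Set (Site (F.P K) (i + 1))) →
      c.tgt ∈ (castSite '' Set.Icc (tlo (F.P K).L (tLo a ρ) (k - (i + 1))) (thi (F.P K).L (tHi a M ρ) (k - (i + 1))) : Set (Site (F.P K) (i + 1))) → ∀ q : Plaq (F.P K) i,
      (blockOf q.src = c.src.unshift c.dir ∨ blockOf q.src = c.src ∨ blockOf q.src = c.tgt) →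
      dist1 (GaugeField.plaqHol (Averaging.iter (avOfRecord F N K) i (gaugeAct u U₁)) q) < aL i)
    (hint : ∀ i < k, ∀ b' : PBond (F.P K) i, blockOf b'.src = blockOf b'.tgt →
      blockOf b'.src ∈ (castSite '' Set.Icc (tlo (F.P K).L (tLo a ρ) (k - (i + 1))) (thi (F.P K).L (tHi a M ρ) (k - (i + 1))) : Set (Site (F.P K) (i + 1))) →
      dist1 (Averaging.iter (avOfRecord F N K) i (gaugeAct u U₁) b') ≤ τ i)
    (htop : ∀ c : PBond (F.P K) k, c.src ∈ (castSite '' Set.Icc (tlo (F.P K).L (tLo a ρ) (k - k)) (thi (F.P K).L (tHi a M ρ) (k - k)) : Set (Site (F.P K) k)) →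
      c.tgt ∈ (castSite '' Set.Icc (tlo (F.P K).L (tLo a ρ) (k - k)) (thi (F.P K).L (tHi a M ρ) (k - k)) : Set (Site (F.P K) k)) →
      dist1 (Averaging.iter (avOfRecord F N K) k (gaugeAct u U₁) c) ≤ vk)
    (hU₁ : ∀ b : PBond (F.P K) 0, b.src ∈ (castSite '' Set.Icc (tlo (F.P K).L (tLo a ρ) (k - 0)) (thi (F.P K).L (tHi a M ρ) (k - 0)) : Set (Site (F.P K) 0)) →
      b.tgt ∈ (castSite '' Set.Icc (tlo (F.P K).L (tLo a ρ) (k - 0)) (thi (F.P K).L (tHi a M ρ) (k - 0)) : Set (Site (F.P K) 0)) → dist1 (U₁ b) ≤ θ)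
    -- the CANONICAL level boxes (dag-n07-w4 p627154's four equations)
    {lo' hi' : ℕ → Fin (F.P K).d → ℤ}
    (hlo0 : lo' 0 = fun i => ((F.P K).L : ℤ) * (sqLo (F.P K).L a ρ k 1 i - 1))
    (hhi0 : hi' 0 = fun i => ((F.P K).L : ℤ) * (sqHi (F.P K).L a M ρ k 1 i + 1) + (((F.P K).L : ℤ) - 1))
    (hloj : ∀ j, 1 ≤ j → lo' j = sqLo (F.P K).L a ρ k j - 1) (hhij : ∀ j, 1 ≤ j → hi' j = sqHi (F.P K).L a M ρ k j + 1) :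
    ∀ j ≤ k, ∀ y : Site (F.P K) j, y ∈ (castSite '' Set.Icc (lo' j) (hi' j) : Set (Site (F.P K) j)) →
      dist1 ((toMS u j (castSite (lo' j)))⁻¹ * toMS u j y) ≤
        2 * ((F.P K).d * ((((F.P K).L ^ k * (M + 4 * ρ) : ℕ) : ℝ) * (τ 0 + (7 * ((((((F.P K).d + 2) * (F.P K).L : ℕ) : ℝ) ^ 2 / 4) * aL 0) +
            ((((F.P K).d + 1) * ((F.P K).L - 1) : ℕ) : ℝ) * τ 0)) +
          ∑ i ∈ Finset.range k, ((((F.P K).L ^ k * (M + 4 * ρ) / (F.P K).L ^ (i + 1) + 1 : ℕ)) : ℝ) *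
            (if i + 1 < k then τ (i + 1) + (7 * ((((((F.P K).d + 2) * (F.P K).L : ℕ) : ℝ) ^ 2 / 4) * aL (i + 1)) + ((((F.P K).d + 1) * ((F.P K).L - 1) : ℕ) : ℝ) * τ (i + 1))
              else vk) + (((F.P K).L ^ k * (M + 4 * ρ) : ℕ) : ℝ) * θ)) := by
  intro j hj y hy
  -- FILE 15 on the `□̃`-tower, read on the canonical boxes (dag-n07-w6 g2 §1)
  have h15 := centredShearVariation_le_of_blowDown_sub hk1 hk u U₁ (fun j => tlo (F.P K).L (tLo a ρ) (k - j)) (fun j => thi (F.P K).L (tHi a M ρ) (k - j))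
    (fun j hj => tildeTower_lo_step (F.P K).L a ρ hj) (fun j hj => tildeTower_hi_step (F.P K).L a M ρ hj) aL τ ha hτ hvk hθ ht hplaq hint htop hU₁ lo' hi'
    (fun j _ => castSite_levelBoxes_subset_tildeTower a M hρ hk1 hlo0 hhi0 hloj hhij j) j hj y hy
  refine h15.trans ?_
  -- every coordinate's width is `≤ D`; the layer sum is monotone; `d` equal terms
  have hκ : ∀ i < k, 0 ≤ (if i + 1 < k then τ (i + 1) + (7 * ((((((F.P K).d + 2) * (F.P K).L : ℕ) : ℝ) ^ 2 / 4) * aL (i + 1)) +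
      ((((F.P K).d + 1) * ((F.P K).L - 1) : ℕ) : ℝ) * τ (i + 1)) else vk) := by
    intro i hi
    split_ifs with h
    · have := ha (i + 1) h; have := hτ (i + 1) h; positivity
    · exact hvk
  have hθ0 : 0 ≤ τ 0 + (7 * ((((((F.P K).d + 2) * (F.P K).L : ℕ) : ℝ) ^ 2 / 4) * aL 0) + ((((F.P K).d + 1) * ((F.P K).L - 1) : ℕ) : ℝ) * τ 0) := by
    have := ha 0 (by omega); have := hτ 0 (by omega); positivity
  have hmono := layerSum_mono (L := (F.P K).L) (fun i => if i + 1 < k then τ (i + 1) + (7 * ((((((F.P K).d + 2) * (F.P K).L : ℕ) : ℝ) ^ 2 / 4) * aL (i + 1)) +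
      ((((F.P K).d + 1) * ((F.P K).L - 1) : ℕ) : ℝ) * τ (i + 1)) else vk) hθ0 hκ
  have hterm : ∀ κ : Fin (F.P K).d,
      ((((thi (F.P K).L (tHi a M ρ) (k - 0) κ - tlo (F.P K).L (tLo a ρ) (k - 0) κ).toNat : ℕ) : ℝ) * (τ 0 + (7 * ((((((F.P K).d + 2) * (F.P K).L : ℕ) : ℝ) ^ 2 / 4) * aL 0) +
            ((((F.P K).d + 1) * ((F.P K).L - 1) : ℕ) : ℝ) * τ 0)) +
          ∑ i ∈ Finset.range k, ((((thi (F.P K).L (tHi a M ρ) (k - 0) κ - tlo (F.P K).L (tLo a ρ) (k - 0) κ).toNat / (F.P K).L ^ (i + 1) + 1 : ℕ)) : ℝ) *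
            (if i + 1 < k then τ (i + 1) + (7 * ((((((F.P K).d + 2) * (F.P K).L : ℕ) : ℝ) ^ 2 / 4) * aL (i + 1)) + ((((F.P K).d + 1) * ((F.P K).L - 1) : ℕ) : ℝ) * τ (i + 1))
              else vk)) + (((thi (F.P K).L (tHi a M ρ) (k - 0) κ - tlo (F.P K).L (tLo a ρ) (k - 0) κ).toNat : ℕ) : ℝ) * θ ≤
      ((((F.P K).L ^ k * (M + 4 * ρ) : ℕ) : ℝ) * (τ 0 + (7 * ((((((F.P K).d + 2) * (F.P K).L : ℕ) : ℝ) ^ 2 / 4) * aL 0) +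
            ((((F.P K).d + 1) * ((F.P K).L - 1) : ℕ) : ℝ) * τ 0)) +
          ∑ i ∈ Finset.range k, ((((F.P K).L ^ k * (M + 4 * ρ) / (F.P K).L ^ (i + 1) + 1 : ℕ)) : ℝ) *
            (if i + 1 < k then τ (i + 1) + (7 * ((((((F.P K).d + 2) * (F.P K).L : ℕ) : ℝ) ^ 2 / 4) * aL (i + 1)) + ((((F.P K).d + 1) * ((F.P K).L - 1) : ℕ) : ℝ) * τ (i + 1))
              else vk)) + (((F.P K).L ^ k * (M + 4 * ρ) : ℕ) : ℝ) * θ := by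
    intro κ
    have hw : (thi (F.P K).L (tHi a M ρ) (k - 0) κ - tlo (F.P K).L (tLo a ρ) (k - 0) κ).toNat ≤ (F.P K).L ^ k * (M + 4 * ρ) := by
      rw [Nat.sub_zero]; exact width_tildeTower_zero_le a ρ k hM κ
    exact add_le_add (hmono hw) (mul_le_mul_of_nonneg_right (by exact_mod_cast hw) hθ)
  refine mul_le_mul_of_nonneg_left ?_ (by norm_num)
  refine (Finset.sum_le_sum fun κ (_ : κ ∈ (Finset.univ : Finset (Fin (F.P K).d))) => hterm κ).trans (le_of_eq ?_)
  rw [Finset.sum_const, Finset.card_univ, Fintype.card_fin, nsmul_eq_mul]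

end Shear

/-! ## §2  The door at the head's family with the shear letter supplied -/

section Door

open scoped Classical in
/-- ★★★★ **THE ς-DOOR AT THE HEAD's FAMILY AND WINDOW WITH THE SHEAR LETTER SUPPLIED** (FILE 11 `…_recordShearVariation_dominated_cubeDomains_box` ∘ §1 ∘ FILE 13): at
`D := cubeDomains (F.P K) a M ρ (K − n)`, window `π '' □′`, canonical weights and canonical level boxes, for every shear gauge `u♮`, every shift family `λ` dominated by the (r1) letter
family, S3's gauge `u` of `U` with the (152) equation and letter `t` on `□′`'s region (the door's) AND on a bond set `B ⊇` the fine bonds of `□̃` (the Landau side of the shear), per-level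
letters `a_i, τ_i` of the averages of `(U^{u})^{u♮}` on the `□̃`-tower, top letter `v_k`, `1 ≤ M`, `0 ≤ t`, `η_{K−n}t ≤ 1`, and the smallness `ς_□̃ ≤ ½`:
`LocalGaugeSplitOn (π '' □′) η_{K−n} t (t₁ + (t₂ + t_∂) + t₃) U` for every `t_∂ > 2CB₃·(4ς_□̃)`, `ς_□̃ = 2d·(D·θ₀ + Σ_{i<k}(D ∕ L^{i+1} + 1)·θ_{i+1} + D·2η_{K−n}t)`, `D = Lᵏ(M + 4ρ)`, `k = K − n`.
[cite: Balaban1985Variational, (144)–(145) pp.300–301, (150)–(152) p.301, (157)–(159) pp.302–303, (164)–(165) p.304, (168) p.304; Balaban1985RegularSpaces, p.98, (1.131) p.99, Lemma 1 (1.25) p.79; Balaban1984PropagatorsII, (2.1)–(2.4) p.224, Cor. 2.8 (2.150)–(2.151) p.249; Balaban1985Averaging, (8) p.19, (85)–(88) p.31; Balaban1987RG1, (0.1) p.251, (1.13) p.262] -/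
theorem localGaugeSplitOn_of_gauge152_recordShearTildeTower_cubeDomains_box (F : T4Family) (N : ℕ) [NeZero N] :
    ∃ (Mh₀ R₀ : ℕ) (C δ₀ δ₁ B₃ : ℝ), 0 ≤ C ∧ 0 < δ₀ ∧ 0 < δ₁ ∧ 0 < B₃ ∧
    ∀ (n K : ℕ) (_ : 1 ≤ K - n) (_ : K - n + 1 ≤ F.m + K) (hk : K - n ≤ (F.P K).m + (F.P K).K)
      {Mh R a' : ℕ} (_ : Mh = F.L ^ a') (_ : Mh₀ ≤ Mh) (_ : R₀ ≤ R) (_ : a' + 3 ≤ F.m + n)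
      {a : Pt (F.P K).d} {M ρ : ℕ} (_ : 1 ≤ M)
      (_ : F.L * Mh ∣ ρ) (_ : ∀ i, ((F.L * Mh : ℕ) : ℤ) ∣ a i) (_ : F.L * Mh ∣ M) (_ : F.L * Mh ∣ (F.P K).sitesPerDir (K - n)) (_ : R * (F.L * Mh) ≤ ρ)
      (_ : F.L ≤ ρ) (_ : Set.InjOn (cover (F.P K)) (cube (F.P K).L a M ρ (K - n) 0))
      {HV : (BondIdx (cubeDomains (F.P K) a M ρ (K - n) hk) → MatA N) →ₗ[ℂ] (PBond (F.P K) 0 → MatA N)}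
      (_ : ∀ (B' : BondIdx (cubeDomains (F.P K) a M ρ (K - n) hk) → MatA N) (b : PBond (F.P K) 0),
        HV B' b = ∑ c, ((flatH (F.P K) (K - n) (cubeDomains (F.P K) a M ρ (K - n) hk) (Pi.single c 1) b : ℝ) : ℂ) • B' c)
      -- the CANONICAL level boxes of the tower (four equation binders)
      {lo hi : ℕ → Pt (F.P K).d}
      (_ : lo 0 = fun i => ((F.P K).L : ℤ) * (sqLo (F.P K).L a ρ (K - n) 1 i - 1))
      (_ : hi 0 = fun i => ((F.P K).L : ℤ) * (sqHi (F.P K).L a M ρ (K - n) 1 i + 1) + (((F.P K).L : ℤ) - 1))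
      (_ : ∀ j, 1 ≤ j → lo j = sqLo (F.P K).L a ρ (K - n) j - 1) (_ : ∀ j, 1 ≤ j → hi j = sqHi (F.P K).L a M ρ (K - n) j + 1)
      -- the shear gauge `u♮`; the shift family, DOMINATED by the (r1) letter family, and its datum
      (uL : GaugeTransf (F.P K) 0 (SU N))
      (lam : (j : ℕ) → Site (F.P K) j → MatA N)
      (_ : ∀ (j : ℕ) (y : Site (F.P K) j), ‖lam j y‖ ≤ ‖mlog (((((toMS uL j (castSite (lo j)))⁻¹ * toMS uL j y)⁻¹ : SU N)) : MatA N)‖)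
      {X : BondIdx (cubeDomains (F.P K) a M ρ (K - n) hk) → MatA N}
      (_ : ∀ c : BondIdx (cubeDomains (F.P K) a M ρ (K - n) hk),
        X c = LatticeFieldCalculus.grad (((F.P K).L : ℝ) ^ (K - n) / ((F.P K).L : ℝ) ^ (c.1.1 : ℕ)) (lam c.1.1) c.1.2)
      -- S3's gauge of `U` on the window, the (159)-splitting of `A − H_V X`
      {U : GaugeField (F.P K) 0 (SU N)} (u : GaugeTransf (F.P K) 0 (SU N)) {A A₁ A₂ A₃ : PBond (F.P K) 0 → MatA N} {t t₁ t₂ t₃ : ℝ}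
      (_ : ∀ b ∈ (Sect2.regionOfSet (F.P K) (cover (F.P K) '' box (F.P K).L a M (K - n))).bonds,
        gaugeU (fun x => ιSU N (u x)) (fun b' => ιSU N (U b')) b = expI ((F.P K).eta (K - n)) (A b))
      (_ : ∀ b ∈ (Sect2.regionOfSet (F.P K) (cover (F.P K) '' box (F.P K).L a M (K - n))).bonds, ‖A b‖ < t)
      (_ : ∀ q ∈ (Sect2.regionOfSet (F.P K) (cover (F.P K) '' box (F.P K).L a M (K - n))).dpairs,
        ‖grad ((F.P K).eta (K - n)) q.2.1 (fun y => A ⟨y, q.2.2⟩) q.1‖ < t)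
      (_ : ∀ b, A b - HV X b = A₁ b + A₂ b - A₃ b)
      (_ : Letters10On (cover (F.P K) '' box (F.P K).L a M (K - n)) ((F.P K).eta (K - n)) t₁ A₁)
      (_ : Letters10On (cover (F.P K) '' box (F.P K).L a M (K - n)) ((F.P K).eta (K - n)) t₂ A₂)
      (_ : Letters10On (cover (F.P K) '' box (F.P K).L a M (K - n)) ((F.P K).eta (K - n)) t₃ A₃)
      -- ★ the Landau side of the shear: the (152) equation and letter on a bond set containing the fine bonds of `□̃` (LOCATED-LANDAU-REGION), `0 ≤ t`, `η t ≤ 1`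
      (_ : 0 ≤ t) (_ : (F.P K).eta (K - n) * t ≤ 1) {B : Set (PBond (F.P K) 0)}
      (_ : ∀ b ∈ B, gaugeU (fun x => ιSU N (u x)) (fun b' => ιSU N (U b')) b = expI ((F.P K).eta (K - n)) (A b)) (_ : ∀ b ∈ B, ‖A b‖ < t)
      (_ : ∀ b : PBond (F.P K) 0,
        b.src ∈ (castSite '' Set.Icc (tlo (F.P K).L (tLo a ρ) (K - n - 0)) (thi (F.P K).L (tHi a M ρ) (K - n - 0)) : Set (Site (F.P K) 0)) →
        b.tgt ∈ (castSite '' Set.Icc (tlo (F.P K).L (tLo a ρ) (K - n - 0)) (thi (F.P K).L (tHi a M ρ) (K - n - 0)) : Set (Site (F.P K) 0)) → b ∈ B)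
      -- ★ the data lane's letters on the `□̃`-tower for the averages of the representative `(U^{u})^{u♮}`: plaquettes, within-block, top
      (aL τ : ℕ → ℝ) {vk : ℝ} (_ : ∀ i < K - n, 0 ≤ aL i) (_ : ∀ i < K - n, 0 ≤ τ i) (_ : 0 ≤ vk)
      (_ : ∀ i < K - n, (((((F.P K).d + 2) * (F.P K).L : ℕ) : ℝ) ^ 2 / 4) * aL i < deltaSU (Fin N))
      (_ : ∀ i < K - n, ∀ c : PBond (F.P K) (i + 1),
        c.src ∈ (castSite '' Set.Icc (tlo (F.P K).L (tLo a ρ) (K - n - (i + 1))) (thi (F.P K).L (tHi a M ρ) (K - n - (i + 1))) : Set (Site (F.P K) (i + 1))) →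
        c.tgt ∈ (castSite '' Set.Icc (tlo (F.P K).L (tLo a ρ) (K - n - (i + 1))) (thi (F.P K).L (tHi a M ρ) (K - n - (i + 1))) : Set (Site (F.P K) (i + 1))) → ∀ q : Plaq (F.P K) i,
        (blockOf q.src = c.src.unshift c.dir ∨ blockOf q.src = c.src ∨ blockOf q.src = c.tgt) →
        dist1 (GaugeField.plaqHol (Averaging.iter (avOfRecord F N K) i (gaugeAct uL (gaugeAct u U))) q) < aL i)
      (_ : ∀ i < K - n, ∀ b' : PBond (F.P K) i, blockOf b'.src = blockOf b'.tgt →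
        blockOf b'.src ∈ (castSite '' Set.Icc (tlo (F.P K).L (tLo a ρ) (K - n - (i + 1))) (thi (F.P K).L (tHi a M ρ) (K - n - (i + 1))) : Set (Site (F.P K) (i + 1))) →
        dist1 (Averaging.iter (avOfRecord F N K) i (gaugeAct uL (gaugeAct u U)) b') ≤ τ i)
      (_ : ∀ c : PBond (F.P K) (K - n),
        c.src ∈ (castSite '' Set.Icc (tlo (F.P K).L (tLo a ρ) (K - n - (K - n))) (thi (F.P K).L (tHi a M ρ) (K - n - (K - n))) : Set (Site (F.P K) (K - n))) →
        c.tgt ∈ (castSite '' Set.Icc (tlo (F.P K).L (tLo a ρ) (K - n - (K - n))) (thi (F.P K).L (tHi a M ρ) (K - n - (K - n))) : Set (Site (F.P K) (K - n))) →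
        dist1 (Averaging.iter (avOfRecord F N K) (K - n) (gaugeAct uL (gaugeAct u U)) c) ≤ vk)
      -- ★ ONE smallness on the explicit shear letter
      (_ : 2 * ((F.P K).d * ((((F.P K).L ^ (K - n) * (M + 4 * ρ) : ℕ) : ℝ) * (τ 0 + (7 * ((((((F.P K).d + 2) * (F.P K).L : ℕ) : ℝ) ^ 2 / 4) * aL 0) +
            ((((F.P K).d + 1) * ((F.P K).L - 1) : ℕ) : ℝ) * τ 0)) +
          ∑ i ∈ Finset.range (K - n), ((((F.P K).L ^ (K - n) * (M + 4 * ρ) / (F.P K).L ^ (i + 1) + 1 : ℕ)) : ℝ) *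
            (if i + 1 < K - n then τ (i + 1) + (7 * ((((((F.P K).d + 2) * (F.P K).L : ℕ) : ℝ) ^ 2 / 4) * aL (i + 1)) + ((((F.P K).d + 1) * ((F.P K).L - 1) : ℕ) : ℝ) * τ (i + 1))
              else vk) + (((F.P K).L ^ (K - n) * (M + 4 * ρ) : ℕ) : ℝ) * (2 * ((F.P K).eta (K - n) * t)))) ≤ 1 / 2)
      {tD : ℝ} (_ : 2 * C * B₃ * (4 * (2 * ((F.P K).d * ((((F.P K).L ^ (K - n) * (M + 4 * ρ) : ℕ) : ℝ) * (τ 0 + (7 * ((((((F.P K).d + 2) * (F.P K).L : ℕ) : ℝ) ^ 2 / 4) * aL 0) +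
            ((((F.P K).d + 1) * ((F.P K).L - 1) : ℕ) : ℝ) * τ 0)) +
          ∑ i ∈ Finset.range (K - n), ((((F.P K).L ^ (K - n) * (M + 4 * ρ) / (F.P K).L ^ (i + 1) + 1 : ℕ)) : ℝ) *
            (if i + 1 < K - n then τ (i + 1) + (7 * ((((((F.P K).d + 2) * (F.P K).L : ℕ) : ℝ) ^ 2 / 4) * aL (i + 1)) + ((((F.P K).d + 1) * ((F.P K).L - 1) : ℕ) : ℝ) * τ (i + 1))
              else vk) + (((F.P K).L ^ (K - n) * (M + 4 * ρ) : ℕ) : ℝ) * (2 * ((F.P K).eta (K - n) * t)))))) < tD),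
      LocalGaugeSplitOn (cover (F.P K) '' box (F.P K).L a M (K - n)) ((F.P K).eta (K - n)) t (t₁ + (t₂ + tD) + t₃) U := by
  obtain ⟨Mh₀, R₀, C, δ₀, δ₁, B₃, hC, hδ₀, hδ₁, hB₃, hmain⟩ := localGaugeSplitOn_of_gauge152_recordShearVariation_dominated_cubeDomains_box F N
  refine ⟨Mh₀, R₀, C, δ₀, δ₁, B₃, hC, hδ₀, hδ₁, hB₃, ?_⟩
  intro n K hk1 hk' hk Mh R a' hMha hMh hR hsize a M ρ hM1 hρ ha hM hper hRρ hLρ hinj HV hHV lo hi hlo0 hhi0 hloj hhij uL lam hlam X hX U u A A₁ A₂ A₃ t t₁ t₂ t₃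
    he hA hdA h159 h₁ h₂ h₃ ht0 hηt B heB hAB hB aL τ vk haL hτ hvk htL hplaq hint htop hςhalf tD htD
  have hρ1 : 1 ≤ ρ := le_trans (by have := F.hL11; omega) hLρ
  have hη : 0 ≤ (F.P K).eta (K - n) := by unfold Params.eta; positivity
  -- the Landau per-bond letter `θ := 2ηt` on the fine bonds of `□̃` (FILE 13)
  have hU₁ : ∀ b : PBond (F.P K) 0,
      b.src ∈ (castSite '' Set.Icc (tlo (F.P K).L (tLo a ρ) (K - n - 0)) (thi (F.P K).L (tHi a M ρ) (K - n - 0)) : Set (Site (F.P K) 0)) →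
      b.tgt ∈ (castSite '' Set.Icc (tlo (F.P K).L (tLo a ρ) (K - n - 0)) (thi (F.P K).L (tHi a M ρ) (K - n - 0)) : Set (Site (F.P K) 0)) →
      dist1 (gaugeAct u U b) ≤ 2 * ((F.P K).eta (K - n) * t) := fun b hs htg =>
    N07LandauBondLetter.dist1_gaugeAct_le_of_gauge152 N u U hη hηt heB hAB b (hB b hs htg)
  have hθ : (0 : ℝ) ≤ 2 * ((F.P K).eta (K - n) * t) := by positivity
  -- §1: the shear letter on the canonical boxes
  have hvar := centredShearVariation_le_tildeTower_levelBoxes hk1 hk uL (gaugeAct u U) a hρ1 hM1 aL τ haL hτ hvk hθ htL hplaq hint htop hU₁ hlo0 hhi0 hloj hhij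
  -- `0 ≤ ς_□̃`
  have hς0 : (0 : ℝ) ≤ 2 * ((F.P K).d * ((((F.P K).L ^ (K - n) * (M + 4 * ρ) : ℕ) : ℝ) * (τ 0 + (7 * ((((((F.P K).d + 2) * (F.P K).L : ℕ) : ℝ) ^ 2 / 4) * aL 0) +
            ((((F.P K).d + 1) * ((F.P K).L - 1) : ℕ) : ℝ) * τ 0)) +
          ∑ i ∈ Finset.range (K - n), ((((F.P K).L ^ (K - n) * (M + 4 * ρ) / (F.P K).L ^ (i + 1) + 1 : ℕ)) : ℝ) *
            (if i + 1 < K - n then τ (i + 1) + (7 * ((((((F.P K).d + 2) * (F.P K).L : ℕ) : ℝ) ^ 2 / 4) * aL (i + 1)) + ((((F.P K).d + 1) * ((F.P K).L - 1) : ℕ) : ℝ) * τ (i + 1))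
              else vk) + (((F.P K).L ^ (K - n) * (M + 4 * ρ) : ℕ) : ℝ) * (2 * ((F.P K).eta (K - n) * t)))) := by
    have h0 : 0 ≤ τ 0 := hτ 0 (by omega)
    have h0' : 0 ≤ aL 0 := haL 0 (by omega)
    have hs : 0 ≤ ∑ i ∈ Finset.range (K - n), ((((F.P K).L ^ (K - n) * (M + 4 * ρ) / (F.P K).L ^ (i + 1) + 1 : ℕ)) : ℝ) *
        (if i + 1 < K - n then τ (i + 1) + (7 * ((((((F.P K).d + 2) * (F.P K).L : ℕ) : ℝ) ^ 2 / 4) * aL (i + 1)) + ((((F.P K).d + 1) * ((F.P K).L - 1) : ℕ) : ℝ) * τ (i + 1))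
          else vk) := by
      refine Finset.sum_nonneg fun i hi => mul_nonneg (by positivity) ?_
      split_ifs with h
      · have := haL (i + 1) h; have := hτ (i + 1) h; positivity
      · exact hvk
    positivity
  exact hmain n K hk1 hk' hk hMha hMh hR hsize hρ ha hM hper hRρ hLρ hinj hHV hlo0 hhi0 hloj hhij uL hς0 hςhalf hvar lam hlam hX u he hA hdA h159 h₁ h₂ h₃ htD


/-! ## §3  Radial edition -/

open scoped Classical in
/-- ★★★★ **RADIAL EDITION** of `localGaugeSplitOn_of_gauge152_recordShearTildeTower_cubeDomains_box`: the within-block letters SUPPLIED — the averages `Mⁱ((U^{u})^{u♮})`, `i < K − n`, carry the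
RADIAL axial gauge (`hax`) and their level-`i` plaquettes based in the blocks of `□̃^{(i+1)}` are `< a_i` (`hplaqB`), so `τ_i := (d(L−1)+1)·((d−1)(L−1)·a_i)` by dag-n07-w6's
`N07DataDownTheRadialTower.hint_of_radialTower` (dag-n07-w5 p630918); otherwise as the generic edition: at
`D := cubeDomains (F.P K) a M ρ (K − n)`, window `π '' □′`, canonical weights and canonical level boxes, for every shear gauge `u♮`, every shift family `λ` dominated by the (r1) letter
family, S3's gauge `u` of `U` with the (152) equation and letter `t` on `□′`'s region (the door's) AND on a bond set `B ⊇` the fine bonds of `□̃` (the Landau side of the shear), per-level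
letters `a_i, τ_i` of the averages of `(U^{u})^{u♮}` on the `□̃`-tower, top letter `v_k`, `1 ≤ M`, `0 ≤ t`, `η_{K−n}t ≤ 1`, and the smallness `ς_□̃ ≤ ½`:
`LocalGaugeSplitOn (π '' □′) η_{K−n} t (t₁ + (t₂ + t_∂) + t₃) U` for every `t_∂ > 2CB₃·(4ς_□̃)`, `ς_□̃ = 2d·(D·θ₀ + Σ_{i<k}(D ∕ L^{i+1} + 1)·θ_{i+1} + D·2η_{K−n}t)`, `D = Lᵏ(M + 4ρ)`, `k = K − n`.
[cite: Balaban1985Variational, (144)–(145) pp.300–301, (150)–(152) p.301, (157)–(159) pp.302–303, (164)–(165) p.304, (168) p.304; Balaban1985RegularSpaces, p.98, (1.131) p.99, Lemma 1 (1.25) p.79; Balaban1984PropagatorsII, (2.1)–(2.4) p.224, Cor. 2.8 (2.150)–(2.151) p.249; Balaban1985Averaging, (8) p.19, (85)–(88) p.31; Balaban1987RG1, (0.1) p.251, (1.13) p.262] -/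
theorem localGaugeSplitOn_of_gauge152_recordShearRadialTildeTower_cubeDomains_box (F : T4Family) (N : ℕ) [NeZero N] :
    ∃ (Mh₀ R₀ : ℕ) (C δ₀ δ₁ B₃ : ℝ), 0 ≤ C ∧ 0 < δ₀ ∧ 0 < δ₁ ∧ 0 < B₃ ∧
    ∀ (n K : ℕ) (_ : 1 ≤ K - n) (_ : K - n + 1 ≤ F.m + K) (hk : K - n ≤ (F.P K).m + (F.P K).K)
      {Mh R a' : ℕ} (_ : Mh = F.L ^ a') (_ : Mh₀ ≤ Mh) (_ : R₀ ≤ R) (_ : a' + 3 ≤ F.m + n)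
      {a : Pt (F.P K).d} {M ρ : ℕ} (_ : 1 ≤ M)
      (_ : F.L * Mh ∣ ρ) (_ : ∀ i, ((F.L * Mh : ℕ) : ℤ) ∣ a i) (_ : F.L * Mh ∣ M) (_ : F.L * Mh ∣ (F.P K).sitesPerDir (K - n)) (_ : R * (F.L * Mh) ≤ ρ)
      (_ : F.L ≤ ρ) (_ : Set.InjOn (cover (F.P K)) (cube (F.P K).L a M ρ (K - n) 0))
      {HV : (BondIdx (cubeDomains (F.P K) a M ρ (K - n) hk) → MatA N) →ₗ[ℂ] (PBond (F.P K) 0 → MatA N)}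
      (_ : ∀ (B' : BondIdx (cubeDomains (F.P K) a M ρ (K - n) hk) → MatA N) (b : PBond (F.P K) 0),
        HV B' b = ∑ c, ((flatH (F.P K) (K - n) (cubeDomains (F.P K) a M ρ (K - n) hk) (Pi.single c 1) b : ℝ) : ℂ) • B' c)
      -- the CANONICAL level boxes of the tower (four equation binders)
      {lo hi : ℕ → Pt (F.P K).d}
      (_ : lo 0 = fun i => ((F.P K).L : ℤ) * (sqLo (F.P K).L a ρ (K - n) 1 i - 1))
      (_ : hi 0 = fun i => ((F.P K).L : ℤ) * (sqHi (F.P K).L a M ρ (K - n) 1 i + 1) + (((F.P K).L : ℤ) - 1))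
      (_ : ∀ j, 1 ≤ j → lo j = sqLo (F.P K).L a ρ (K - n) j - 1) (_ : ∀ j, 1 ≤ j → hi j = sqHi (F.P K).L a M ρ (K - n) j + 1)
      -- the shear gauge `u♮`; the shift family, DOMINATED by the (r1) letter family, and its datum
      (uL : GaugeTransf (F.P K) 0 (SU N))
      (lam : (j : ℕ) → Site (F.P K) j → MatA N)
      (_ : ∀ (j : ℕ) (y : Site (F.P K) j), ‖lam j y‖ ≤ ‖mlog (((((toMS uL j (castSite (lo j)))⁻¹ * toMS uL j y)⁻¹ : SU N)) : MatA N)‖)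
      {X : BondIdx (cubeDomains (F.P K) a M ρ (K - n) hk) → MatA N}
      (_ : ∀ c : BondIdx (cubeDomains (F.P K) a M ρ (K - n) hk),
        X c = LatticeFieldCalculus.grad (((F.P K).L : ℝ) ^ (K - n) / ((F.P K).L : ℝ) ^ (c.1.1 : ℕ)) (lam c.1.1) c.1.2)
      -- S3's gauge of `U` on the window, the (159)-splitting of `A − H_V X`
      {U : GaugeField (F.P K) 0 (SU N)} (u : GaugeTransf (F.P K) 0 (SU N)) {A A₁ A₂ A₃ : PBond (F.P K) 0 → MatA N} {t t₁ t₂ t₃ : ℝ}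
      (_ : ∀ b ∈ (Sect2.regionOfSet (F.P K) (cover (F.P K) '' box (F.P K).L a M (K - n))).bonds,
        gaugeU (fun x => ιSU N (u x)) (fun b' => ιSU N (U b')) b = expI ((F.P K).eta (K - n)) (A b))
      (_ : ∀ b ∈ (Sect2.regionOfSet (F.P K) (cover (F.P K) '' box (F.P K).L a M (K - n))).bonds, ‖A b‖ < t)
      (_ : ∀ q ∈ (Sect2.regionOfSet (F.P K) (cover (F.P K) '' box (F.P K).L a M (K - n))).dpairs,
        ‖grad ((F.P K).eta (K - n)) q.2.1 (fun y => A ⟨y, q.2.2⟩) q.1‖ < t)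
      (_ : ∀ b, A b - HV X b = A₁ b + A₂ b - A₃ b)
      (_ : Letters10On (cover (F.P K) '' box (F.P K).L a M (K - n)) ((F.P K).eta (K - n)) t₁ A₁)
      (_ : Letters10On (cover (F.P K) '' box (F.P K).L a M (K - n)) ((F.P K).eta (K - n)) t₂ A₂)
      (_ : Letters10On (cover (F.P K) '' box (F.P K).L a M (K - n)) ((F.P K).eta (K - n)) t₃ A₃)
      -- ★ the Landau side of the shear: the (152) equation and letter on a bond set containing the fine bonds of `□̃` (LOCATED-LANDAU-REGION), `0 ≤ t`, `η t ≤ 1`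
      (_ : 0 ≤ t) (_ : (F.P K).eta (K - n) * t ≤ 1) {B : Set (PBond (F.P K) 0)}
      (_ : ∀ b ∈ B, gaugeU (fun x => ιSU N (u x)) (fun b' => ιSU N (U b')) b = expI ((F.P K).eta (K - n)) (A b)) (_ : ∀ b ∈ B, ‖A b‖ < t)
      (_ : ∀ b : PBond (F.P K) 0,
        b.src ∈ (castSite '' Set.Icc (tlo (F.P K).L (tLo a ρ) (K - n - 0)) (thi (F.P K).L (tHi a M ρ) (K - n - 0)) : Set (Site (F.P K) 0)) →
        b.tgt ∈ (castSite '' Set.Icc (tlo (F.P K).L (tLo a ρ) (K - n - 0)) (thi (F.P K).L (tHi a M ρ) (K - n - 0)) : Set (Site (F.P K) 0)) → b ∈ B)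
      -- ★ the data lane's letters on the `□̃`-tower for the averages of the representative `(U^{u})^{u♮}`: plaquettes, within-block, top
      (aL : ℕ → ℝ) {vk : ℝ} (_ : ∀ i < K - n, 0 ≤ aL i) (_ : 0 ≤ vk)
      (_ : ∀ i < K - n, AxialGauge (radialContourData (F.P K) i (SU N)) (Averaging.iter (avOfRecord F N K) i (gaugeAct uL (gaugeAct u U))))
      (_ : ∀ i < K - n, (((((F.P K).d + 2) * (F.P K).L : ℕ) : ℝ) ^ 2 / 4) * aL i < deltaSU (Fin N))
      (_ : ∀ i < K - n, ∀ c : PBond (F.P K) (i + 1),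
        c.src ∈ (castSite '' Set.Icc (tlo (F.P K).L (tLo a ρ) (K - n - (i + 1))) (thi (F.P K).L (tHi a M ρ) (K - n - (i + 1))) : Set (Site (F.P K) (i + 1))) →
        c.tgt ∈ (castSite '' Set.Icc (tlo (F.P K).L (tLo a ρ) (K - n - (i + 1))) (thi (F.P K).L (tHi a M ρ) (K - n - (i + 1))) : Set (Site (F.P K) (i + 1))) → ∀ q : Plaq (F.P K) i,
        (blockOf q.src = c.src.unshift c.dir ∨ blockOf q.src = c.src ∨ blockOf q.src = c.tgt) →
        dist1 (GaugeField.plaqHol (Averaging.iter (avOfRecord F N K) i (gaugeAct uL (gaugeAct u U))) q) < aL i)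
      (_ : ∀ i < K - n, ∀ y : Site (F.P K) (i + 1),
        y ∈ (castSite '' Set.Icc (tlo (F.P K).L (tLo a ρ) (K - n - (i + 1))) (thi (F.P K).L (tHi a M ρ) (K - n - (i + 1))) : Set (Site (F.P K) (i + 1))) →
        ∀ q : Plaq (F.P K) i, blockOf q.src = y → dist1 (GaugeField.plaqHol (Averaging.iter (avOfRecord F N K) i (gaugeAct uL (gaugeAct u U))) q) < aL i)
      (_ : ∀ c : PBond (F.P K) (K - n),
        c.src ∈ (castSite '' Set.Icc (tlo (F.P K).L (tLo a ρ) (K - n - (K - n))) (thi (F.P K).L (tHi a M ρ) (K - n - (K - n))) : Set (Site (F.P K) (K - n))) →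
        c.tgt ∈ (castSite '' Set.Icc (tlo (F.P K).L (tLo a ρ) (K - n - (K - n))) (thi (F.P K).L (tHi a M ρ) (K - n - (K - n))) : Set (Site (F.P K) (K - n))) →
        dist1 (Averaging.iter (avOfRecord F N K) (K - n) (gaugeAct uL (gaugeAct u U)) c) ≤ vk)
      -- ★ ONE smallness on the explicit shear letter
      (_ : 2 * ((F.P K).d * ((((F.P K).L ^ (K - n) * (M + 4 * ρ) : ℕ) : ℝ) * (((((F.P K).d * ((F.P K).L - 1) + 1 : ℕ) : ℝ) * (((((F.P K).d - 1 : ℕ) : ℝ) * (((F.P K).L - 1 : ℕ) : ℝ)) * aL 0)) + (7 * ((((((F.P K).d + 2) * (F.P K).L : ℕ) : ℝ) ^ 2 / 4) * aL 0) +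
            ((((F.P K).d + 1) * ((F.P K).L - 1) : ℕ) : ℝ) * ((((F.P K).d * ((F.P K).L - 1) + 1 : ℕ) : ℝ) * (((((F.P K).d - 1 : ℕ) : ℝ) * (((F.P K).L - 1 : ℕ) : ℝ)) * aL 0)))) +
          ∑ i ∈ Finset.range (K - n), ((((F.P K).L ^ (K - n) * (M + 4 * ρ) / (F.P K).L ^ (i + 1) + 1 : ℕ)) : ℝ) *
            (if i + 1 < K - n then ((((F.P K).d * ((F.P K).L - 1) + 1 : ℕ) : ℝ) * (((((F.P K).d - 1 : ℕ) : ℝ) * (((F.P K).L - 1 : ℕ) : ℝ)) * aL (i + 1))) + (7 * ((((((F.P K).d + 2) * (F.P K).L : ℕ) : ℝ) ^ 2 / 4) * aL (i + 1)) + ((((F.P K).d + 1) * ((F.P K).L - 1) : ℕ) : ℝ) * ((((F.P K).d * ((F.P K).L - 1) + 1 : ℕ) : ℝ) * (((((F.P K).d - 1 : ℕ) : ℝ) * (((F.P K).L - 1 : ℕ) : ℝ)) * aL (i + 1))))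
              else vk) + (((F.P K).L ^ (K - n) * (M + 4 * ρ) : ℕ) : ℝ) * (2 * ((F.P K).eta (K - n) * t)))) ≤ 1 / 2)
      {tD : ℝ} (_ : 2 * C * B₃ * (4 * (2 * ((F.P K).d * ((((F.P K).L ^ (K - n) * (M + 4 * ρ) : ℕ) : ℝ) * (((((F.P K).d * ((F.P K).L - 1) + 1 : ℕ) : ℝ) * (((((F.P K).d - 1 : ℕ) : ℝ) * (((F.P K).L - 1 : ℕ) : ℝ)) * aL 0)) + (7 * ((((((F.P K).d + 2) * (F.P K).L : ℕ) : ℝ) ^ 2 / 4) * aL 0) +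
            ((((F.P K).d + 1) * ((F.P K).L - 1) : ℕ) : ℝ) * ((((F.P K).d * ((F.P K).L - 1) + 1 : ℕ) : ℝ) * (((((F.P K).d - 1 : ℕ) : ℝ) * (((F.P K).L - 1 : ℕ) : ℝ)) * aL 0)))) +
          ∑ i ∈ Finset.range (K - n), ((((F.P K).L ^ (K - n) * (M + 4 * ρ) / (F.P K).L ^ (i + 1) + 1 : ℕ)) : ℝ) *
            (if i + 1 < K - n then ((((F.P K).d * ((F.P K).L - 1) + 1 : ℕ) : ℝ) * (((((F.P K).d - 1 : ℕ) : ℝ) * (((F.P K).L - 1 : ℕ) : ℝ)) * aL (i + 1))) + (7 * ((((((F.P K).d + 2) * (F.P K).L : ℕ) : ℝ) ^ 2 / 4) * aL (i + 1)) + ((((F.P K).d + 1) * ((F.P K).L - 1) : ℕ) : ℝ) * ((((F.P K).d * ((F.P K).L - 1) + 1 : ℕ) : ℝ) * (((((F.P K).d - 1 : ℕ) : ℝ) * (((F.P K).L - 1 : ℕ) : ℝ)) * aL (i + 1))))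
              else vk) + (((F.P K).L ^ (K - n) * (M + 4 * ρ) : ℕ) : ℝ) * (2 * ((F.P K).eta (K - n) * t)))))) < tD),
      LocalGaugeSplitOn (cover (F.P K) '' box (F.P K).L a M (K - n)) ((F.P K).eta (K - n)) t (t₁ + (t₂ + tD) + t₃) U := by
  obtain ⟨Mh₀, R₀, C, δ₀, δ₁, B₃, hC, hδ₀, hδ₁, hB₃, hmain⟩ := localGaugeSplitOn_of_gauge152_recordShearVariation_dominated_cubeDomains_box F N
  refine ⟨Mh₀, R₀, C, δ₀, δ₁, B₃, hC, hδ₀, hδ₁, hB₃, ?_⟩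
  intro n K hk1 hk' hk Mh R a' hMha hMh hR hsize a M ρ hM1 hρ ha hM hper hRρ hLρ hinj HV hHV lo hi hlo0 hhi0 hloj hhij uL lam hlam X hX U u A A₁ A₂ A₃ t t₁ t₂ t₃
    he hA hdA h159 h₁ h₂ h₃ ht0 hηt B heB hAB hB aL vk haL hvk hax htL hplaq hplaqB htop hςhalf tD htD
  have hρ1 : 1 ≤ ρ := le_trans (by have := F.hL11; omega) hLρ
  have hη : 0 ≤ (F.P K).eta (K - n) := by unfold Params.eta; positivity
  -- the Landau per-bond letter `θ := 2ηt` on the fine bonds of `□̃` (FILE 13)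
  have hU₁ : ∀ b : PBond (F.P K) 0,
      b.src ∈ (castSite '' Set.Icc (tlo (F.P K).L (tLo a ρ) (K - n - 0)) (thi (F.P K).L (tHi a M ρ) (K - n - 0)) : Set (Site (F.P K) 0)) →
      b.tgt ∈ (castSite '' Set.Icc (tlo (F.P K).L (tLo a ρ) (K - n - 0)) (thi (F.P K).L (tHi a M ρ) (K - n - 0)) : Set (Site (F.P K) 0)) →
      dist1 (gaugeAct u U b) ≤ 2 * ((F.P K).eta (K - n) * t) := fun b hs htg =>
    N07LandauBondLetter.dist1_gaugeAct_le_of_gauge152 N u U hη hηt heB hAB b (hB b hs htg)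
  have hθ : (0 : ℝ) ≤ 2 * ((F.P K).eta (K - n) * t) := by positivity
  -- the within-block letters of the radial tower (dag-n07-w6 `hint_of_radialTower`)
  have hτ : ∀ j < K - n, (0 : ℝ) ≤ ((((F.P K).d * ((F.P K).L - 1) + 1 : ℕ) : ℝ) * (((((F.P K).d - 1 : ℕ) : ℝ) * (((F.P K).L - 1 : ℕ) : ℝ)) * aL j)) :=
    fun j hj => by have := haL j hj; positivity
  have hint := N07DataDownTheRadialTower.hint_of_radialTower hk _ hax
    (fun i => (castSite '' Set.Icc (tlo (F.P K).L (tLo a ρ) (K - n - i)) (thi (F.P K).L (tHi a M ρ) (K - n - i)) : Set (Site (F.P K) i))) aL haL hplaqB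
  -- §1: the shear letter on the canonical boxes
  have hvar := centredShearVariation_le_tildeTower_levelBoxes hk1 hk uL (gaugeAct u U) a hρ1 hM1 aL
    (fun i => ((((F.P K).d * ((F.P K).L - 1) + 1 : ℕ) : ℝ) * (((((F.P K).d - 1 : ℕ) : ℝ) * (((F.P K).L - 1 : ℕ) : ℝ)) * aL i))) haL hτ hvk hθ htL hplaq hint htop hU₁ hlo0 hhi0 hloj hhij
  -- `0 ≤ ς_□̃`
  have hς0 : (0 : ℝ) ≤ 2 * ((F.P K).d * ((((F.P K).L ^ (K - n) * (M + 4 * ρ) : ℕ) : ℝ) * (((((F.P K).d * ((F.P K).L - 1) + 1 : ℕ) : ℝ) * (((((F.P K).d - 1 : ℕ) : ℝ) * (((F.P K).L - 1 : ℕ) : ℝ)) * aL 0)) + (7 * ((((((F.P K).d + 2) * (F.P K).L : ℕ) : ℝ) ^ 2 / 4) * aL 0) +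
            ((((F.P K).d + 1) * ((F.P K).L - 1) : ℕ) : ℝ) * ((((F.P K).d * ((F.P K).L - 1) + 1 : ℕ) : ℝ) * (((((F.P K).d - 1 : ℕ) : ℝ) * (((F.P K).L - 1 : ℕ) : ℝ)) * aL 0)))) +
          ∑ i ∈ Finset.range (K - n), ((((F.P K).L ^ (K - n) * (M + 4 * ρ) / (F.P K).L ^ (i + 1) + 1 : ℕ)) : ℝ) *
            (if i + 1 < K - n then ((((F.P K).d * ((F.P K).L - 1) + 1 : ℕ) : ℝ) * (((((F.P K).d - 1 : ℕ) : ℝ) * (((F.P K).L - 1 : ℕ) : ℝ)) * aL (i + 1))) + (7 * ((((((F.P K).d + 2) * (F.P K).L : ℕ) : ℝ) ^ 2 / 4) * aL (i + 1)) + ((((F.P K).d + 1) * ((F.P K).L - 1) : ℕ) : ℝ) * ((((F.P K).d * ((F.P K).L - 1) + 1 : ℕ) : ℝ) * (((((F.P K).d - 1 : ℕ) : ℝ) * (((F.P K).L - 1 : ℕ) : ℝ)) * aL (i + 1))))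
              else vk) + (((F.P K).L ^ (K - n) * (M + 4 * ρ) : ℕ) : ℝ) * (2 * ((F.P K).eta (K - n) * t)))) := by
    have h0 : 0 ≤ ((((F.P K).d * ((F.P K).L - 1) + 1 : ℕ) : ℝ) * (((((F.P K).d - 1 : ℕ) : ℝ) * (((F.P K).L - 1 : ℕ) : ℝ)) * aL 0)) := hτ 0 (by omega)
    have h0' : 0 ≤ aL 0 := haL 0 (by omega)
    have hs : 0 ≤ ∑ i ∈ Finset.range (K - n), ((((F.P K).L ^ (K - n) * (M + 4 * ρ) / (F.P K).L ^ (i + 1) + 1 : ℕ)) : ℝ) *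
        (if i + 1 < K - n then ((((F.P K).d * ((F.P K).L - 1) + 1 : ℕ) : ℝ) * (((((F.P K).d - 1 : ℕ) : ℝ) * (((F.P K).L - 1 : ℕ) : ℝ)) * aL (i + 1))) + (7 * ((((((F.P K).d + 2) * (F.P K).L : ℕ) : ℝ) ^ 2 / 4) * aL (i + 1)) + ((((F.P K).d + 1) * ((F.P K).L - 1) : ℕ) : ℝ) * ((((F.P K).d * ((F.P K).L - 1) + 1 : ℕ) : ℝ) * (((((F.P K).d - 1 : ℕ) : ℝ) * (((F.P K).L - 1 : ℕ) : ℝ)) * aL (i + 1))))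
          else vk) := by
      refine Finset.sum_nonneg fun i hi => mul_nonneg (by positivity) ?_
      split_ifs with h
      · have := haL (i + 1) h; have := hτ (i + 1) h; positivity
      · exact hvk
    positivity
  exact hmain n K hk1 hk' hk hMha hMh hR hsize hρ ha hM hper hRρ hLρ hinj hHV hlo0 hhi0 hloj hhij uL hς0 hςhalf hvar lam hlam hX u he hA hdA h159 h₁ h₂ h₃ htD

end Door

end Summit.QuantumFields.YangMills.BalabanUVNodes.N07SplitClauseOfTildeTower

end
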